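import Summits.BirchSwinnertonDyer.Rank1Residual.Additive.SpecialJSupersingular
import Literature.NumberTheory.EllipticCurves.ComplexMultiplicationDeuring0Proofs
import HarnessLib

/-!
# The trace law for `j = 0`: `a² + 3m² = 4q`, and anomalous reduction only when `4p = 3m² + 1`

HONEST FRAMING (cell `b2b-bsdres`, run/shared/lean/b2b/bsd-rank1-residual/, verbatim in every
file): the goal of the cell is to DELETE the COMBINATION-SHAPED residual classes of the
Birch–Swinnerton-Dyer formula for ALL analytic-rank `≤ 1` elliptic curves over `ℚ` — "full BSD
formula for every rank `≤ 1` curve in class `C`" assembled STRICTLY from published theorems — so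
that the rank-`≤ 1` remainder becomes exactly the CONSTRUCTION-SHAPED classes, which are TYPED
(missing-input `Prop`s), NOT attempted. This is not "finishing BSD". Sub-cell `additive-p2`
(X3♯(G-ord) / X4♯(G-ord)), generation 34: research route; no claim beyond the stated classes;
theorems only, no definition, no named fact, nothing booked, no label moved.

## What is proved (NUMERICS ⇒ STRUCTURE ⇒ THEOREM)

Gen 11's anomalous census over the minimal (G)-field (`census/anom/ANOM-CENSUS.md`, 1280 pairs) shows
that the defect-`3`/`6` rows (Kodaira `II`, `IV`, `IV*`, `II*`; reduction `j̃ = 0`) are anomalous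
ONLY at `p ∈ {7, 19}` (50/261 at `7`, 4/12 at `19`; 0/57 at `13`, 0/2 at `43`, 0/1 at `97`) and that
`a_𝔭² + 3m² = 4p` is solvable on all 334 of them. Both facts are theorems of Gauss (Ireland–Rosen,
GTM 84, Ch. 18 §3 Thm. 4: for `p ≡ 1 (mod 3)` the trace of `y² = x³ + D` over `𝔽_p` is `−(π + π̄)`
with `π ∈ ℤ[ω]`, `ππ̄ = p`), whose character-sum proof the tree already holds for GLOBAL `j = 0`
curves (`Literature.….ComplexMultiplicationDeuring0Proofs`: `sum_quadraticChar_cube_add`,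
`jacobiSum_mul_conj`, Mathlib's `jacobiSum_mul_jacobiSum_inv`). This file runs the same proof for an
ARBITRARY elliptic curve with `j = 0` over a finite field — the reductions `Ẽ_w` of the (G)-cell are
not reductions of global `j = 0` curves — and reads off the anomalous criterion:

* `SpecialJ.exists_sq_add_three_mul_sq_eq_of_mem_cmRing` — the norm form of `ℤ[ω]`: `π ∈ ℤ[ω]`,
  `π + π̄ = t`, `ππ̄ = n` ⟹ `t² + 3m² = 4n` for some `m ∈ ℤ`;
* `SpecialJ.exists_trace_eq_add_conj_of_a₄_eq_zero` — `E : y² = x³ + B` elliptic over a finite field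
  `F` of odd characteristic with `3 ∣ #F − 1`: `#F + 1 − #E(F) = π + π̄`, `π ∈ ℤ[ω]`, `ππ̄ = #F`;
* **`SpecialJ.exists_trace_sq_add_three_mul_sq_of_j_eq_zero`** — `j(E) = 0`, characteristic `p ≥ 5`,
  `3 ∣ #F − 1` ⟹ **`(#F + 1 − #E(F))² + 3m² = 4·#F`** for some `m ∈ ℤ` (the trace law; Hasse's
  bound `a² ≤ 4q` is a corollary, with the defect `4q − a²` three times a square);
* **`SpecialJ.exists_three_mul_sq_add_one_eq_of_dvd_natCard_point_of_j_eq_zero`** — over a field with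
  a PRIME number `p ≥ 5` of elements: `j(E) = 0` and `p ∣ #E(𝔽_p)` (ANOMALOUS) ⟹ **`3m² + 1 = 4p`**
  for some `m ∈ ℕ` (`p ≢ 1 (mod 3)`: supersingular, `#E = p + 1`, never anomalous, gen 9's
  `ringChar_dvd_trace_of_j_eq_zero`; `p ≡ 1 (mod 3)`: `a ≡ 1 (mod p)` and `a² ≤ 4p` force `a = 1`);
  contrapositive `SpecialJ.not_dvd_natCard_point_of_j_eq_zero_of_forall_ne`, Greenberg's currency
  `SpecialJ.natCard_primaryComponent_point_eq_one_of_j_eq_zero_of_forall_ne`, and the bounded search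
  `SpecialJ.forall_three_mul_sq_add_one_ne_of_le` (`m ≤ p` suffices; e.g. `p = 13`: `decide`).

So the primes at which a `j̃ = 0` reduction over `𝔽_p` CAN be anomalous are exactly those with
`4p = 3m² + 1`: `7, 19, 37, 61, 127, 271, 331, 397, …` (`m = 3, 5, 7, 9, 13, 19, 21, 23, …`); at
`p = 13, 31, 43, 67, 73, 79, 97, 103, 109, …` (all `≡ 1 (mod 3)`) it never is. The sibling file
`GordNonAnomalousThreeSix.lean` (gen 34 part 2) carries this to the degree-one good places of the
(G)-cell at defect `3`/`6` (`Delbourgo2002.ReductionNonAnomalous W p` by theorem there), the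
companion of gen 11's defect-`4` theorem (`GordNonAnomalousFour.lean`, `j̃ = 1728`, `p ≥ 7`).

References: K. Ireland, M. Rosen, GTM 84 (2nd ed. 1990), Ch. 18 §3 Thm. 4 and its proof, Ch. 8 §3;
C. F. Gauss, *Disquisitiones* §358; B. Mazur, Invent. Math. 18 (1972) 183–266 (anomalous primes);
J. H. Silverman, *AEC* V.1.1, Ex. V.4.4; R. Greenberg, LNM 1716 (1999) Thm. 4.1; D. Delbourgo,
J. Number Theory 95 (2002) p. 39 (`ℓ_p(E)`). Tree: `ComplexMultiplicationDeuring0Proofs` (x10 / CM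
lane), `SpecialJOrdinary/Supersingular` (gens 3, 9), `HasseElementary`.
-/

noncomputable section

open scoped Classical ComplexConjugate

open Finset WeierstrassCurve Literature.NumberTheory.EllipticCurves
  Literature.NumberTheory.EllipticCurves.HasseElementary

namespace Summit.BirchSwinnertonDyer.Rank1Residual.Additive

namespace SpecialJ

/-! ### The norm form of `ℤ[ω]` -/

/-- **The norm form of `ℤ[ω]`.** If `π ∈ ℤ[ω] = ℤ[ω_{-3}] ⊂ ℂ` has integer trace `t = π + π̄` and
integer norm `n = ππ̄`, then `t² + 3m² = 4n` for some `m ∈ ℤ`: with `π = a + bω_{-3}`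
(`ω_{-3} = (−3 + √−3)/2`), `t = 2a − 3b`, `n = a² − 3ab + 3b²`, take `m = b`.
Ireland–Rosen Ch. 1 §4 / Ch. 9 §1 (`N(a + bω) = a² − ab + b²`). [folklore] -/
theorem exists_sq_add_three_mul_sq_eq_of_mem_cmRing {π : ℂ} (hπ : π ∈ cmRing (-3)) {t n : ℤ}
    (ht : (t : ℂ) = π + conj π) (hn : (n : ℂ) = π * conj π) :
    ∃ m : ℤ, t ^ 2 + 3 * m ^ 2 = 4 * n := by
  obtain ⟨a, b, rfl⟩ := (mem_cmRing_iff (d := -3) (c := 3) (by norm_num) (by norm_num)).1 hπ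
  refine ⟨b, ?_⟩
  have h1 : (t : ℂ) = 2 * a - 3 * b := by
    rw [ht, map_add, map_mul, map_intCast, map_intCast, conj_cmGen]
    push_cast
    ring
  have h2 : (n : ℂ) = ((a * a + a * b * (-3) + b * b * 3 : ℤ) : ℂ) := by
    rw [hn, norm_cmRing (d := -3) (c := 3) (by norm_num) (by norm_num)]
  have h1' : t = 2 * a - 3 * b := by exact_mod_cast h1
  have h2' : n = a * a + a * b * (-3) + b * b * 3 := by exact_mod_cast h2
  rw [h1', h2']
  ring

/-! ### `y² = x³ + B` over a finite field with `3 ∣ q − 1`: the trace is `π + π̄`, `ππ̄ = q` -/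

section ShortNF

variable {F : Type*} [Field F] [Fintype F] (E : WeierstrassCurve F) [E.IsShortNF] [E.IsElliptic]

/-- **Gauss / Ireland–Rosen for an arbitrary `y² = x³ + B` over `𝔽_q`, `q ≡ 1 (mod 3)`, `q` odd.**
For `E : y² = x³ + B` elliptic (`a₄ = 0`, so `B ≠ 0`) over a finite field `F` of odd characteristic
with `3 ∣ #F − 1`: there is `π ∈ ℤ[ω]` with `ππ̄ = #F` and `#F + 1 − #E(F) = π + π̄`. Proof: the
trace is `−Σ_x ρ(x³ + B)` (`ρ` the quadratic character, gen 3's `trace_eq_neg_sum_quadraticChar`);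
a cubic character `χ` of order `3` exists (Mathlib `MulChar.exists_mulChar_orderOf`);
`Σ_x ρ(x³ + B) = cJ + \overline{cJ}` with `J = J(χ, ρ)`, `c = ρ(B)χ(−B)` (the tree's
`sum_quadraticChar_cube_add`), `JJ̄ = #F` (`jacobiSum_mul_conj`), `cc̄ = 1`; `π := −cJ`.
[cite: IrelandRosen1990, Ch. 18 §3, Theorem 4 and its proof (PDF pp. 298–299)] -/
theorem exists_trace_eq_add_conj_of_a₄_eq_zero (hF : ringChar F ≠ 2) (ha : E.a₄ = 0)
    (h3 : 3 ∣ Fintype.card F - 1) :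
    ∃ π : ℂ, π ∈ cmRing (-3) ∧ π * conj π = Fintype.card F ∧
      (((Fintype.card F : ℤ) + 1 - Nat.card E.toAffine.Point : ℤ) : ℂ) = π + conj π := by
  obtain ⟨χ, hχ⟩ := MulChar.exists_mulChar_orderOf F h3 isPrimitiveRoot_one_add_cmGen
  set B := E.a₆ with hB
  have hB0 : B ≠ 0 := by
    intro h0
    have hΔ : E.Δ = 0 := by rw [E.Δ_of_isShortNF, ha, ← hB, h0]; ring
    exact E.isUnit_Δ.ne_zero hΔ
  have hft : ((Fintype.card F : ℤ) + 1 - Nat.card E.toAffine.Point) =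
      -∑ x : F, (quadraticChar F (x ^ 3 + B) : ℤ) := by
    rw [trace_eq_neg_sum_quadraticChar E hF]
    congr 1
    refine sum_congr rfl fun x _ ↦ ?_
    rw [eval_cubic, ha, ← hB, zero_mul, add_zero]
  set ρ : MulChar F ℂ := (quadraticChar F).ringHomComp (Int.castRingHom ℂ) with hρ
  have key := sum_quadraticChar_cube_add hF hχ hB0
  have hnorm := jacobiSum_mul_conj hF hχ
  rw [← hρ] at key hnorm
  set c : ℂ := ρ B * χ (-B) with hc
  set J : ℂ := jacobiSum χ ρ with hJ
  have hcc : c * conj c = 1 := by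
    have hz3 : χ (-B) ^ 3 = 1 := apply_pow_three_eq_one hχ (neg_ne_zero.mpr hB0)
    have hz0 : χ (-B) ≠ 0 := by
      intro h0; rw [h0] at hz3; norm_num at hz3
    have hχc : χ (-B) * conj (χ (-B)) = 1 := by
      rw [conj_eq_inv_of_pow_eq_one three_ne_zero hz3, mul_inv_cancel₀ hz0]
    have hρc : ρ B * conj (ρ B) = 1 := by
      rw [(conj_quadraticChar_ringHomComp B).1, hρ, MulChar.ringHomComp_apply, eq_intCast]
      rcases quadraticChar_dichotomy hB0 with h | h <;> rw [h] <;> norm_num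
    rw [hc, map_mul]
    linear_combination conj (ρ B) * ρ B * hχc + hρc
  refine ⟨-(c * J), ?_, ?_, ?_⟩
  · refine neg_mem (mul_mem (mul_mem ?_ (apply_mem_cmRing hχ _)) (jacobiSum_mem_cmRing hχ))
    rw [hρ, MulChar.ringHomComp_apply, eq_intCast]
    exact intCast_mem _ _
  · rw [map_neg, neg_mul_neg, map_mul]
    calc c * J * (conj c * conj J) = (c * conj c) * (J * conj J) := by ring
      _ = (Fintype.card F : ℂ) := by rw [hcc, hnorm, one_mul]
  · have hC : (((Fintype.card F : ℤ) + 1 - Nat.card E.toAffine.Point : ℤ) : ℂ) =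
        -∑ x : F, ρ (x ^ 3 + B) := by
      rw [hft]
      push_cast
      simp only [hρ, MulChar.ringHomComp_apply, eq_intCast]
    rw [hC, key, map_neg]
    ring

/-- **The trace law for `y² = x³ + B`**: over a finite field `F` of odd characteristic with
`3 ∣ #F − 1`, `(#F + 1 − #E(F))² + 3m² = 4·#F` for some `m ∈ ℤ`.
[cite: IrelandRosen1990, Ch. 18 §3, Theorem 4] -/
theorem exists_trace_sq_add_three_mul_sq_of_a₄_eq_zero (hF : ringChar F ≠ 2) (ha : E.a₄ = 0)
    (h3 : 3 ∣ Fintype.card F - 1) :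
    ∃ m : ℤ, ((Fintype.card F : ℤ) + 1 - Nat.card E.toAffine.Point) ^ 2 + 3 * m ^ 2 =
      4 * Fintype.card F := by
  obtain ⟨π, hπ, hn, ht⟩ := exists_trace_eq_add_conj_of_a₄_eq_zero E hF ha h3
  exact exists_sq_add_three_mul_sq_eq_of_mem_cmRing hπ ht (by push_cast; exact hn.symm)

end ShortNF

/-! ### General equations with `j = 0` in characteristic `p ≥ 5` -/

section General

variable {F : Type*} [Field F] [Fintype F] (E : WeierstrassCurve F) [E.IsElliptic] {p : ℕ}

/-- **THE TRACE LAW FOR `j = 0`.** For an elliptic curve `E` with `j(E) = 0` over a finite field `F`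
of characteristic `p ≥ 5` with `3 ∣ #F − 1`: **`(#F + 1 − #E(F))² + 3m² = 4·#F` for some
`m ∈ ℤ`** — the trace is the trace of an element of `ℤ[ω]` of norm `#F`. Reduction to the short
model `y² = x³ + B` (`E.toShortNF • E`, same point count by the tree's `VariableChange.pointEquiv`;
`j = 0 ⟺ c₄ = 0 ⟺ a₄ = 0`). Gauss; Ireland–Rosen Ch. 18 §3 Thm. 4; cf. Cox, *Primes of the form
x² + ny²*, Thm. 14.16 (`a_p = π + π̄`). [cite: IrelandRosen1990, Ch. 18 §3, Theorem 4] -/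
theorem exists_trace_sq_add_three_mul_sq_of_j_eq_zero (hchar : ringChar F = p) (hp5 : 5 ≤ p)
    (hj : E.j = 0) (h3 : 3 ∣ Fintype.card F - 1) :
    ∃ m : ℤ, ((Fintype.card F : ℤ) + 1 - Nat.card E.toAffine.Point) ^ 2 + 3 * m ^ 2 =
      4 * Fintype.card F := by
  obtain ⟨h2, h3'⟩ := ringChar_ne_two_and_ne_three (F := F) hchar hp5
  obtain ⟨h2', h3''⟩ := two_ne_zero_and_three_ne_zero h2 h3'
  haveI : Invertible (2 : F) := invertibleOfNonzero h2'
  haveI : Invertible (3 : F) := invertibleOfNonzero h3''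
  haveI : (E.toShortNF • E).IsShortNF := E.toShortNF_spec
  have hjS : (E.toShortNF • E).j = 0 := by rw [variableChange_j, hj]
  have hc4 : (E.toShortNF • E).c₄ = 0 := (j_eq_zero_iff _).mp hjS
  have ha4 : (E.toShortNF • E).a₄ = 0 := by
    rw [(E.toShortNF • E).c₄_of_isShortNF] at hc4
    have h48 : (-48 : F) ≠ 0 := by
      rw [show (-48 : F) = -(2 ^ 4 * 3) by norm_num]
      exact neg_ne_zero.mpr (mul_ne_zero (pow_ne_zero _ h2') h3'')
    exact (mul_eq_zero.mp hc4).resolve_left h48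
  rw [Nat.card_congr (VariableChange.pointEquiv E E.toShortNF).toEquiv]
  exact exists_trace_sq_add_three_mul_sq_of_a₄_eq_zero (E.toShortNF • E) (by omega) ha4 h3

end General

/-! ### Prime fields: anomalous only when `4p = 3m² + 1` -/

section PrimeField

variable {k : Type*} [Field k] [Finite k] (E : WeierstrassCurve k) [E.IsElliptic] {p : ℕ}

/-- `Nat.card` form of the trace law (residue fields of number fields are `Finite`, not `Fintype`):
`j(E) = 0`, characteristic `p ≥ 5`, `3 ∣ #k − 1` ⟹ `(#k + 1 − #E(k))² + 3m² = 4·#k`.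
[cite: IrelandRosen1990, Ch. 18 §3, Theorem 4] -/
theorem exists_trace_sq_add_three_mul_sq_of_j_eq_zero_of_ringChar_eq [Fact p.Prime]
    (hchar : ringChar k = p) (hp5 : 5 ≤ p) (hj : E.j = 0) (h3 : 3 ∣ Nat.card k - 1) :
    ∃ m : ℤ, ((Nat.card k : ℤ) + 1 - Nat.card E.toAffine.Point) ^ 2 + 3 * m ^ 2 = 4 * Nat.card k := by
  haveI := Fintype.ofFinite k
  rw [Nat.card_eq_fintype_card] at h3 ⊢
  exact exists_trace_sq_add_three_mul_sq_of_j_eq_zero E hchar hp5 hj h3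

/-- **ANOMALOUS `j = 0` CURVES OVER `𝔽_p` EXIST ONLY WHEN `4p = 3m² + 1`.** For an elliptic curve `E`
over a field `k` with a prime number `p ≥ 5` of elements and `j(E) = 0`: if `p ∣ #E(k)` (Mazur's
anomalous condition, `a_p ≡ 1 (mod p)`) then `3m² + 1 = 4p` for some `m ∈ ℕ`. If `p ≢ 1 (mod 3)` the
curve is supersingular (`#E(k) = p + 1`, gen 9's `ringChar_dvd_trace_of_j_eq_zero`), never
anomalous; if `p ≡ 1 (mod 3)` the trace law `a² + 3m² = 4p` gives `a² ≤ 4p < (p − 1)²` (`p ≥ 7`),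
and `a ≡ 1 (mod p)` forces `a = 1`. Mazur 1972 §5 (anomalous primes); Ireland–Rosen Ch. 18 §3 Thm. 4.
[cite: IrelandRosen1990, Ch. 18 §3, Theorem 4] -/
theorem exists_three_mul_sq_add_one_eq_of_dvd_natCard_point_of_j_eq_zero (hp : p.Prime)
    (hp5 : 5 ≤ p) (hcard : Nat.card k = p) (hj : E.j = 0)
    (hdvd : p ∣ Nat.card E.toAffine.Point) : ∃ m : ℕ, 3 * m ^ 2 + 1 = 4 * p := by
  haveI := Fintype.ofFinite k
  haveI : Fact p.Prime := ⟨hp⟩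
  obtain ⟨hchar, hq⟩ := ringChar_eq_of_natCard_eq (k := k) hp hcard
  obtain ⟨c, hc⟩ := hdvd
  by_cases h3 : 3 ∣ p - 1
  · have hp7 : 7 ≤ p := by
      rcases (show p = 5 ∨ p = 6 ∨ 7 ≤ p by omega) with rfl | rfl | h
      · exfalso; omega
      · exfalso; norm_num at hp
      · exact h
    obtain ⟨m, hm⟩ := exists_trace_sq_add_three_mul_sq_of_j_eq_zero E hchar hp5 hj (hq ▸ h3)
    rw [hq, hc] at hm
    push_cast at hm
    have hp7Z : (7 : ℤ) ≤ p := by exact_mod_cast hp7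
    rcases c with _ | c
    · -- `#E = 0`: `(p + 1)² ≤ 4p` is impossible
      exfalso
      simp only [Nat.cast_zero, mul_zero, sub_zero] at hm
      nlinarith [sq_nonneg m]
    rcases c with _ | c
    · -- `#E = p`: `a = 1`
      refine ⟨m.natAbs, ?_⟩
      have h1 : (1 : ℤ) + 3 * m ^ 2 = 4 * p := by
        simp only [zero_add, Nat.cast_one, mul_one] at hm
        linear_combination hm
      have h2 : ((3 * m.natAbs ^ 2 + 1 : ℕ) : ℤ) = ((4 * p : ℕ) : ℤ) := by
        push_cast
        rw [sq_abs]
        linarith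
      exact_mod_cast h2
    · -- `#E ≥ 2p`: `a² ≥ (p − 1)² > 4p`
      exfalso
      have hc1 : (1 : ℤ) ≤ (c : ℤ) + 1 := by
        have : (0 : ℤ) ≤ c := by exact_mod_cast Nat.zero_le c
        linarith
      have ht : (p : ℤ) - 1 ≤ (p : ℤ) * ((c : ℤ) + 1 + 1) - (p + 1) := by nlinarith
      have ht0 : (0 : ℤ) ≤ (p : ℤ) - 1 := by linarith
      have hsq : ((p : ℤ) - 1) * ((p : ℤ) - 1) ≤
          ((p : ℤ) + 1 - (p : ℤ) * ((c : ℤ) + 1 + 1)) ^ 2 := by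
        rw [show ((p : ℤ) + 1 - (p : ℤ) * ((c : ℤ) + 1 + 1)) ^ 2 =
            ((p : ℤ) * ((c : ℤ) + 1 + 1) - (p + 1)) * ((p : ℤ) * ((c : ℤ) + 1 + 1) - (p + 1)) by
          ring]
        exact mul_le_mul ht ht ht0 (le_trans ht0 ht)
      push_cast at hm
      nlinarith [sq_nonneg m]
  · -- supersingular: `p ∣ p + 1 − #E` and `p ∣ #E` give `p ∣ 1`
    exfalso
    have hss := ringChar_dvd_trace_of_j_eq_zero E hchar hp5 hj h3
    rw [hq, hc] at hss
    push_cast at hss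
    have h1 : (p : ℤ) ∣ 1 := by
      have h : (p : ℤ) ∣ (p : ℤ) + 1 := by
        have h' := dvd_add hss (dvd_mul_right (p : ℤ) (c : ℤ))
        rwa [sub_add_cancel] at h'
      exact dvd_add_self_left.mp h
    have := Int.eq_one_of_dvd_one (by exact_mod_cast Nat.zero_le p) h1
    have hp1 : p = 1 := by exact_mod_cast this
    exact hp.one_lt.ne' hp1

/-- **`j = 0` over `𝔽_p` is NOT anomalous unless `4p = 3m² + 1`**: if `3m² + 1 ≠ 4p` for every
`m ∈ ℕ` (e.g. `p = 13, 31, 43, 67, 73, 79, 97, …`, and every `p ≢ 1 (mod 3)`), then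
`p ∤ #E(𝔽_p)` for every elliptic curve with `j(E) = 0`. Mazur 1972; Ireland–Rosen Ch. 18 §3 Thm. 4.
[cite: IrelandRosen1990, Ch. 18 §3, Theorem 4] -/
theorem not_dvd_natCard_point_of_j_eq_zero_of_forall_ne (hp : p.Prime) (hp5 : 5 ≤ p)
    (hcard : Nat.card k = p) (hj : E.j = 0) (h : ∀ m : ℕ, 3 * m ^ 2 + 1 ≠ 4 * p) :
    ¬ p ∣ Nat.card E.toAffine.Point := fun hdvd ↦ by
  obtain ⟨m, hm⟩ :=
    exists_three_mul_sq_add_one_eq_of_dvd_natCard_point_of_j_eq_zero E hp hp5 hcard hj hdvd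
  exact h m hm

/-- The same in the currency of Greenberg's Theorem 4.1 (`#Ẽ(𝔽_p)[p^∞]`): for `j = 0` over `𝔽_p`
with `3m² + 1 ≠ 4p` for all `m`, **`#E(𝔽_p)[p^∞] = 1`**. [cite: GreenbergLNM1716, Thm. 4.1] -/
theorem natCard_primaryComponent_point_eq_one_of_j_eq_zero_of_forall_ne (hp : p.Prime)
    (hp5 : 5 ≤ p) (hcard : Nat.card k = p) (hj : E.j = 0) (h : ∀ m : ℕ, 3 * m ^ 2 + 1 ≠ 4 * p) :
    Nat.card (AddCommGroup.primaryComponent E.toAffine.Point p) = 1 := by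
  haveI : Fact p.Prime := ⟨hp⟩
  have hnd := not_dvd_natCard_point_of_j_eq_zero_of_forall_ne E hp hp5 hcard hj h
  have hbot : AddCommGroup.primaryComponent E.toAffine.Point p = ⊥ := by
    refine (AddSubgroup.eq_bot_iff_forall _).mpr fun g hg ↦ ?_
    obtain ⟨n, hn⟩ := (AddCommGroup.mem_primaryComponent (G := E.toAffine.Point) (p := p)).mp hg
    have h1 : addOrderOf g ∣ p ^ n := addOrderOf_dvd_of_nsmul_eq_zero hn
    have h2 : addOrderOf g ∣ Nat.card E.toAffine.Point := addOrderOf_dvd_natCard g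
    have hcop : Nat.Coprime (p ^ n) (Nat.card E.toAffine.Point) :=
      Nat.Coprime.pow_left n ((Nat.Prime.coprime_iff_not_dvd hp).mpr hnd)
    have h3 : addOrderOf g ∣ 1 := by
      rw [← hcop.gcd_eq_one]
      exact Nat.dvd_gcd h1 h2
    exact AddMonoid.addOrderOf_eq_one_iff.mp (Nat.dvd_one.mp h3)
  rw [hbot, AddSubgroup.card_bot]

/-- **Bounded search**: to check `3m² + 1 ≠ 4p` for all `m` it suffices to check `m ≤ p`
(`3(p + 1)² + 1 > 4p`); the finitely many cases are then `decide`d per prime. [folklore] -/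
theorem forall_three_mul_sq_add_one_ne_of_le (h : ∀ m ≤ p, 3 * m ^ 2 + 1 ≠ 4 * p) :
    ∀ m : ℕ, 3 * m ^ 2 + 1 ≠ 4 * p := by
  intro m hm
  by_cases hle : m ≤ p
  · exact h m hle hm
  · rw [not_le] at hle
    nlinarith

/-- Worked instances (the census primes `≡ 1 (mod 3)` below `100` that are NOT of the form
`(3m² + 1)/4`): at `p ∈ {13, 31, 43, 67, 73, 79, 97}` no `j = 0` curve over `𝔽_p` is anomalous.
(`7 = (3·9+1)/4`, `19 = (3·25+1)/4`, `37 = (3·49+1)/4`, `61 = (3·81+1)/4` are.) [folklore] -/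
theorem forall_three_mul_sq_add_one_ne_thirteen : ∀ m : ℕ, 3 * m ^ 2 + 1 ≠ 4 * 13 :=
  forall_three_mul_sq_add_one_ne_of_le (by decide)

end PrimeField

end SpecialJ

end Summit.BirchSwinnertonDyer.Rank1Residual.Additive

end
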